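/-
Copyright (c) 2026. All rights reserved.
Released under Apache 2.0 license as described in the file LICENSE.
Authors: abc-iut cell, seat abc-iut-w5-d050 (gen 5).
-/
import Literature.GroupTheory.ProPPowerMap
import Mathlib.GroupTheory.OrderOfElement

/-!
# Power maps and abstract finite quotients of pro-`Σ` groups

The pro-`Σ` twin (for an arbitrary set of primes `Σ`) of the pro-`p` facts of
`Literature/GroupTheory/ProPPowerMap.lean` (J. D. Dixon, M. du Sautoy, A. Mann, D. Segal, *Analytic
pro-`p` groups*, 2nd ed., §1.3, Lemma 1.18 and its proof, read with a set of primes `Σ` in place of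
`{p}`), in Mathlib-only vocabulary.  A *profinite* group is a
compact, totally disconnected topological group; it is *pro-`Σ`* when every prime dividing the index of
an open normal subgroup lies in `Σ` — the field shape of the cell's `IsProSigma Σ P`
(`Literature/AnabelianGeometry/SemiGraphs/PSCFundamentalGroup.lean`, [CombGC] Def. 1.1 (ii)) and
`IsProSigmaGroup` ([AbsTopII] Def. 3.1); here it is carried as the explicit hypothesis
`hS : ∀ U : OpenNormalSubgroup M, ∀ q, q.Prime → q ∣ (U : Subgroup M).index → q ∈ Σ` (no definition).

* `ProSigma.pow_surjective` / `pow_injective` / `pow_bijective` — for `n` divisible by no prime of `Σ`,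
  `x ↦ x ^ n` is a bijection of a pro-`Σ` group (compactness + `powCoprime` on the finite quotients);
* `ProSigma.prime_mem_of_dvd_index` — **the abstract version of "pro-`Σ`"**: for an ARBITRARY
  (not necessarily closed) subgroup `K` of finite index, every prime dividing `[M : K]` lies in `Σ`
  (DdSMS Lemma 1.18 is the case `Σ = {p}`): otherwise Cauchy's theorem gives an element of order
  `q ∉ Σ` in the finite quotient by the normal core, contradicting the injectivity of the `q`-power map
  there (surjective on `M`, hence surjective, hence injective, on the finite quotient);
* `ProSigma.index_pos_and_prime_mem` — the same packaged as "`[M : K]` is a `Σ`-integer" in the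
  unfolded form `0 < K.index ∧ ∀ q, q.Prime → q ∣ K.index → q ∈ Σ` (= the body of the tree's
  `Anabelioids.IsSigmaInteger Σ K.index`; the bridge to `IsProSigma`/`IsSigmaInteger` is the sibling
  file `Literature/AnabelianGeometry/SemiGraphs/ProSigmaAbstractQuotients.lean`).

Generic profinite lemmas (`eq_one_of_forall_openNormalSubgroup_mem`, `eq_of_forall_quotientMk_eq`,
`nonempty_openNormalSubgroup`) are REUSED from `ProPPowerMap.lean` (abc-iut-w5-d218), not restated.
[cite: DixonEtAl1999, §1.3 Lemma 1.18]
-/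

namespace Literature.GroupTheory

namespace ProSigma

variable {M : Type*} [Group M] [TopologicalSpace M] [IsTopologicalGroup M] [CompactSpace M]
  [TotallyDisconnectedSpace M] {S : Set ℕ}

omit [IsTopologicalGroup M] [CompactSpace M] [TotallyDisconnectedSpace M] in
/-- For a pro-`Σ` group and `n` with no prime factor in `Σ`, the order of every finite quotient
`M ⧸ U` (`U` open normal) is prime to `n`. [cite: DixonEtAl1999, §1.3 Lemma 1.18] -/
theorem card_quotient_coprime (hS : ∀ U : OpenNormalSubgroup M, ∀ q : ℕ, q.Prime →
      q ∣ (U : Subgroup M).index → q ∈ S)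
    {n : ℕ} (hn : ∀ q ∈ S, q.Prime → ¬ q ∣ n) (U : OpenNormalSubgroup M) :
    (Nat.card (M ⧸ (U : Subgroup M))).Coprime n := by
  rw [← Subgroup.index_eq_card]
  refine Nat.coprime_of_dvd fun q hq hqU hqn => ?_
  exact hn q (hS U q hq hqU) hq hqn

/-- **The `n`-power map of a pro-`Σ` group is surjective** for `n` with no prime factor in `Σ`: for
`g ∈ M` and each open normal `U` the set of `y` with `y ^ n / g ∈ U` is closed and nonempty (the power
map of the finite group `M ⧸ U`, whose order is prime to `n`, is the bijection `powCoprime`); these sets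
are directed, so by compactness they share a point `y`, and `y ^ n / g` lies in every open normal
subgroup, hence equals `1`. [cite: DixonEtAl1999, §1.3 Lemma 1.18] -/
theorem pow_surjective (hS : ∀ U : OpenNormalSubgroup M, ∀ q : ℕ, q.Prime →
      q ∣ (U : Subgroup M).index → q ∈ S)
    {n : ℕ} (hn : ∀ q ∈ S, q.Prime → ¬ q ∣ n) : Function.Surjective fun x : M => x ^ n := by
  intro g
  haveI : Nonempty (OpenNormalSubgroup M) := nonempty_openNormalSubgroup
  let A : OpenNormalSubgroup M → Set M := fun U => {y | y ^ n * g⁻¹ ∈ (U : Set M)}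
  have hcont : Continuous fun y : M => y ^ n * g⁻¹ := (continuous_pow n).mul continuous_const
  have hclosed : ∀ U, IsClosed (A U) := fun U => (U.toOpenSubgroup.isClosed).preimage hcont
  have hne : ∀ U, (A U).Nonempty := by
    intro U
    have hcard := card_quotient_coprime hS hn U
    obtain ⟨y, hy⟩ := QuotientGroup.mk_surjective ((powCoprime hcard).symm (g : M ⧸ (U : Subgroup M)))
    refine ⟨y, ?_⟩
    have h1 : ((y ^ n : M) : M ⧸ (U : Subgroup M)) = (g : M ⧸ (U : Subgroup M)) := by
      rw [QuotientGroup.mk_pow, hy, ← powCoprime_apply hcard, Equiv.apply_symm_apply]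
    have h2 := QuotientGroup.eq_iff_div_mem.mp h1
    rw [div_eq_mul_inv] at h2
    exact h2
  have hdir : Directed (fun s t : Set M => s ⊇ t) A := by
    intro U V
    refine ⟨U ⊓ V, ?_, ?_⟩
    · intro y hy; exact (show ((U ⊓ V : OpenNormalSubgroup M) : Set M) ⊆ U from fun z hz => hz.1) hy
    · intro y hy; exact (show ((U ⊓ V : OpenNormalSubgroup M) : Set M) ⊆ V from fun z hz => hz.2) hy
  obtain ⟨y, hy⟩ := IsCompact.nonempty_iInter_of_directed_nonempty_isCompact_isClosed A hdir hne
    (fun U => (hclosed U).isCompact) hclosed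
  refine ⟨y, ?_⟩
  have hmem : ∀ U : OpenNormalSubgroup M, y ^ n * g⁻¹ ∈ U := fun U => Set.mem_iInter.mp hy U
  exact mul_inv_eq_one.mp (eq_one_of_forall_openNormalSubgroup_mem hmem)

/-- **The `n`-power map of a pro-`Σ` group is injective** for `n` with no prime factor in `Σ`
(injective on every finite quotient `M ⧸ U`, `U` open normal, by `powCoprime`).
[cite: DixonEtAl1999, §1.3 Lemma 1.18] -/
theorem pow_injective (hS : ∀ U : OpenNormalSubgroup M, ∀ q : ℕ, q.Prime →
      q ∣ (U : Subgroup M).index → q ∈ S)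
    {n : ℕ} (hn : ∀ q ∈ S, q.Prime → ¬ q ∣ n) : Function.Injective fun x : M => x ^ n := by
  intro x y hxy
  dsimp only at hxy
  refine eq_of_forall_quotientMk_eq fun U => (powCoprime (card_quotient_coprime hS hn U)).injective ?_
  simp only [powCoprime_apply, ← QuotientGroup.mk_pow, hxy]

/-- The `n`-power map of a pro-`Σ` group is a bijection for `n` with no prime factor in `Σ`.
[cite: DixonEtAl1999, §1.3 Lemma 1.18] -/
theorem pow_bijective (hS : ∀ U : OpenNormalSubgroup M, ∀ q : ℕ, q.Prime →
      q ∣ (U : Subgroup M).index → q ∈ S)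
    {n : ℕ} (hn : ∀ q ∈ S, q.Prime → ¬ q ∣ n) : Function.Bijective fun x : M => x ^ n :=
  ⟨pow_injective hS hn, pow_surjective hS hn⟩

/-- In a pro-`Σ` group the `n`-power map, `n` prime to `Σ`, is surjective on every ABSTRACT quotient
group. [cite: DixonEtAl1999, §1.3 Lemma 1.18] -/
theorem pow_surjective_quotient (hS : ∀ U : OpenNormalSubgroup M, ∀ q : ℕ, q.Prime →
      q ∣ (U : Subgroup M).index → q ∈ S)
    {n : ℕ} (hn : ∀ q ∈ S, q.Prime → ¬ q ∣ n) (N : Subgroup M) [N.Normal] :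
    Function.Surjective fun x : M ⧸ N => x ^ n := by
  intro x
  obtain ⟨g, rfl⟩ := QuotientGroup.mk_surjective x
  obtain ⟨y, hy⟩ := pow_surjective hS hn g
  exact ⟨(y : M ⧸ N), by simp only [← QuotientGroup.mk_pow, hy]⟩

/-- **Abstract pro-`Σ`-ness, normal case**: every prime dividing the index of an ABSTRACT normal
subgroup of finite index of a pro-`Σ` group lies in `Σ` (no closedness assumed).
[cite: DixonEtAl1999, §1.3 Lemma 1.18] -/
theorem prime_mem_of_dvd_index_of_normal (hS : ∀ U : OpenNormalSubgroup M, ∀ q : ℕ, q.Prime →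
      q ∣ (U : Subgroup M).index → q ∈ S)
    (N : Subgroup M) [N.Normal] [N.FiniteIndex] {q : ℕ} (hq : q.Prime) (hdvd : q ∣ N.index) :
    q ∈ S := by
  classical
  by_contra hqS
  haveI : Finite (M ⧸ N) := Subgroup.finite_quotient_of_finiteIndex
  letI : Fintype (M ⧸ N) := Fintype.ofFinite _
  haveI : Fact q.Prime := ⟨hq⟩
  rw [Subgroup.index_eq_card, Nat.card_eq_fintype_card] at hdvd
  obtain ⟨x, hx⟩ := exists_prime_orderOf_dvd_card q hdvd
  -- `q` itself has no prime factor in `Σ`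
  have hn : ∀ r ∈ S, r.Prime → ¬ r ∣ q := by
    intro r hr hrp hrq
    have : r = q := (Nat.prime_dvd_prime_iff_eq hrp hq).mp hrq
    exact hqS (this ▸ hr)
  have hsurj := pow_surjective_quotient hS hn N
  have hinj : Function.Injective fun y : M ⧸ N => y ^ q := Finite.injective_iff_surjective.mpr hsurj
  have h1 : x ^ q = (1 : M ⧸ N) ^ q := by rw [one_pow, ← hx, pow_orderOf_eq_one]
  have hx1 : x = 1 := hinj h1
  have : orderOf x = 1 := by rw [hx1, orderOf_one]
  rw [this] at hx
  exact hq.one_lt.ne hx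

/-- **Abstract pro-`Σ`-ness** (DdSMS Lemma 1.18 for `Σ = {p}`): every prime dividing the index of an
ARBITRARY subgroup of finite index of a pro-`Σ` group lies in `Σ`.
[cite: DixonEtAl1999, §1.3 Lemma 1.18] -/
theorem prime_mem_of_dvd_index (hS : ∀ U : OpenNormalSubgroup M, ∀ q : ℕ, q.Prime →
      q ∣ (U : Subgroup M).index → q ∈ S)
    (K : Subgroup M) [K.FiniteIndex] {q : ℕ} (hq : q.Prime) (hdvd : q ∣ K.index) : q ∈ S := by
  haveI := K.normalCore_normal
  haveI := Subgroup.finiteIndex_normalCore K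
  exact prime_mem_of_dvd_index_of_normal hS K.normalCore hq
    (hdvd.trans (Subgroup.index_dvd_of_le K.normalCore_le))

/-- The index of an ABSTRACT subgroup of finite index of a pro-`Σ` group is a `Σ`-integer, in the
unfolded form `0 < [M : K] ∧ (every prime factor ∈ Σ)` (the body of the tree's
`Anabelioids.IsSigmaInteger`). [cite: DixonEtAl1999, §1.3 Lemma 1.18] -/
theorem index_pos_and_prime_mem (hS : ∀ U : OpenNormalSubgroup M, ∀ q : ℕ, q.Prime →
      q ∣ (U : Subgroup M).index → q ∈ S)
    (K : Subgroup M) [K.FiniteIndex] :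
    0 < K.index ∧ ∀ q : ℕ, q.Prime → q ∣ K.index → q ∈ S :=
  ⟨Nat.pos_of_ne_zero Subgroup.FiniteIndex.index_ne_zero,
    fun _ hq hdvd => prime_mem_of_dvd_index hS K hq hdvd⟩

/-- Specialisation `Σ = {p}`: an abstract subgroup of finite index of a pro-`p` group has `p`-power
index (DdSMS Lemma 1.18 in its printed form "|G : K| is a power of p").
[cite: DixonEtAl1999, §1.3 Lemma 1.18] -/
theorem exists_index_eq_prime_pow {p : ℕ} (hp : p.Prime)
    (hS : ∀ U : OpenNormalSubgroup M, ∀ q : ℕ, q.Prime → q ∣ (U : Subgroup M).index → q = p)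
    (K : Subgroup M) [K.FiniteIndex] : ∃ k : ℕ, K.index = p ^ k := by
  have hS' : ∀ U : OpenNormalSubgroup M, ∀ q : ℕ, q.Prime → q ∣ (U : Subgroup M).index →
      q ∈ ({p} : Set ℕ) := fun U q hq hd => by simpa using hS U q hq hd
  have key : ∀ {q : ℕ}, q.Prime → q ∣ K.index → q = p := fun hq hd => by
    simpa using prime_mem_of_dvd_index hS' K hq hd
  have _ := hp
  exact ⟨_, Nat.eq_prime_pow_of_unique_prime_dvd Subgroup.FiniteIndex.index_ne_zero key⟩

end ProSigma

end Literature.GroupTheory
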